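import Summits.NavierStokesRegularity.NavierStokesRegularity.Theses.RellichScar
import Summits.NavierStokesRegularity.NavierStokesRegularity.Theorems.ScarRigidity.Negative.LogicAndLoadBearing
import Summits.NavierStokesRegularity.NavierStokesRegularity.Theorems.RellichScarDefs
import Summits.NavierStokesRegularity.NavierStokesRegularity.Theorems.RellichScarScarRigidityApexMild
import Summits.NavierStokesRegularity.NavierStokesRegularity.Theorems.RellichScarScarRigidityApexRegularity
import Summits.NavierStokesRegularity.NavierStokesRegularity.Theorems.RellichScarScarRigidityMomentLadderReduction
import Summits.NavierStokesRegularity.NavierStokesRegularity.Theorems.RellichScarSelfSimilarApexFatal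
import Summits.NavierStokesRegularity.NavierStokesRegularity.Theorems.RellichScarAxisymmetricApexFatal
import Summits.NavierStokesRegularity.NavierStokesRegularity.Theorems.RellichScarSimilarityCovariance
import Summits.NavierStokesRegularity.NavierStokesRegularity.Theorems.RellichScarSymmetricScarExistsRotWindowRigidity
import Summits.NavierStokesRegularity.NavierStokesRegularity.Theorems.RellichScarScarRigidityDilationGeneratorFlat
import Summits.NavierStokesRegularity.NavierStokesRegularity.Theorems.RellichScarScarRigidityZoomOrbitIncrement
import Summits.NavierStokesRegularity.NavierStokesRegularity.Theorems.RellichScarScarRigidityRotationGeneratorFlat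
import Summits.NavierStokesRegularity.NavierStokesRegularity.Theorems.RellichScarScarRigidityRotationOrbitIncrement
import Literature.Analysis.FluidPDE.TypeIAncientMild
import Summits.NavierStokesRegularity.NavierStokesRegularity.Theorems.RellichScarScarRigidityGeneratorHullGlue
import Literature.Analysis.FluidPDE.SwirlTransportProofs
import HarnessLib

/-!
# `ScarRigidity` — line `SketchIdeator6` (generator–hull), the REDUCTION: scar rigidity from isolation among twins
# (crux stmt-NavierStokesRegularity-11717, route RellichScar; lead a3)

Sorry-free.  With the four platform stubs of the line landed (`stub_dilationGeneratorFlat` p129707,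
`stub_zoomOrbitIncrement` p129650, `stub_rotationGeneratorFlat` p130364, `stub_rotationOrbitIncrement` p129583),
this file proves the whole composition of the line with its two remaining stubs as HYPOTHESES:

* `noHomogeneousScarProfile_of_isolation` — if every singular smooth apex profile is ISOLATED among its singular
  scar twins in the scale-invariant weighted sup-norm `sup (‖x‖+√(−t))³‖·‖/(−t)` (the registered open stub
  `stub_localScarUniqueness`, verbatim, as hypothesis), then NO singular apex profile of the route's class has a
  (−1)-homogeneous scar: the homogeneous scar makes the zoom orbit `λ ↦ λV(λ²·,λ·)` Lipschitz at the smooth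
  representative `V` in that norm (platform stubs), isolation freezes it near `λ = 1`, the log-stabiliser is an open
  subgroup of `ℝ` hence everything (`selfSimilar_of_window`), so the profile is a.e. self-similar and the landed
  `SelfSimilarApexFatal` (Tsai 1998) ends it;
* `noAxisymmetricScarProfile_of_isolation` — likewise for an axisymmetric scar (rotation orbit, `axisymmetric_of_window`,
  `AxisymmetricApexFatal` = Seregin–Šverák 2009);
* `scarRigidity_of_symmetricScarExists_of_isolation` — `ScarRigidity` from the sibling crux `SymmetricScarExists`
  (item stmt-NavierStokesRegularity-11718, as hypothesis) and isolation: a failure of the crux exhibits a singular apex profile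
  (`exists_singular_apex_of_not_scarRigidity`), 11718 upgrades it to one with a symmetric scar, the two theorems above
  exclude both.  The route's `closes` already takes `SymmetricScarExists`, so this adds no dependence to the route.

Glue: `…GeneratorHullGlue.lean` (namespace `GeneratorHull`).  The file closes with the registered tools stub `stub_generatorHullReduction` (conjunction of the three
reductions), so that it lands `--supports` the crux item.
-/

noncomputable section

open Set Filter Function MeasureTheory Metric TopologicalSpace
open scoped Topology ENNReal NNReal InnerProductSpace RealInnerProductSpace

set_option linter.dupNamespace false -- D-0017: `Summit.<S>.<S>.…` repeats the summit name by design

namespace Summit.NavierStokesRegularity.NavierStokesRegularity.Theorems.RellichScarScarRigidity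

open Literature.Analysis.FluidPDE
open Summit.NavierStokesRegularity.NavierStokesRegularity.Theses.RellichScar
open Summit.NavierStokesRegularity.NavierStokesRegularity.Theorems.ScarRigidity.Negative
open MomentLadder

/-- Physical space. -/
local notation "ℝ³" => EuclideanSpace ℝ (Fin 3)

/-- The open backward slab `(-∞,0) × ℝ³`. -/
local notation "𝕊" => Literature.Analysis.FluidPDE.slab (EuclideanSpace ℝ (Fin 3)) (Set.Iio (0 : ℝ)) isOpen_Iio



open GeneratorHull

/-! ## Composition -/

/-- **No singular apex profile has a (−1)-homogeneous scar — from isolation.**  (Smooth representative and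
package: `stub_apexMildRepresentative`, `stub_apexRegularity`; covariance of the apex class: the landed
`SimilarityCovariance`; isolation `stub_localScarUniqueness` freezes the zoom orbit near `λ = 1` by
`stub_dilationGeneratorFlat` + `stub_zoomOrbitIncrement`; window ⇒ exact self-similarity; `SelfSimilarApexFatal`.) -/
theorem noHomogeneousScarProfile_of_isolation (stub_localScarUniqueness :
    (∀ (V : ℝ → ℝ³ → ℝ³) (Q : ℝ → ℝ³ → ℝ) (C : ℝ), 0 < C →
        IsTypeIAncientMild C V → HasTypeIDecay C V → IsClassicalNSSolutionOn (Iio (0 : ℝ)) 1 0 V Q →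
        ScaleInvariantBounds V Q → IsBackwardSingularPoint V 0 →
        ∃ ε : ℝ, 0 < ε ∧ ∀ (V' : ℝ → ℝ³ → ℝ³) (Q' : ℝ → ℝ³ → ℝ),
          IsTypeIAncientMild C V' → HasTypeIDecay C V' → IsClassicalNSSolutionOn (Iio (0 : ℝ)) 1 0 V' Q' →
          ScaleInvariantBounds V' Q' → IsBackwardSingularPoint V' 0 → SameScar V' V →
          (∀ t < 0, ∀ x : ℝ³, ‖V' t x - V t x‖ ≤ ε * ((-t) / (‖x‖ + Real.sqrt (-t)) ^ 3)) →
          ∀ t < 0, ∀ x : ℝ³, V' t x = V t x)) :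
    ∀ (u : ℝ → ℝ³ → ℝ³) (p : ℝ → ℝ³ → ℝ) (G : ℝ → ℝ³ → ℝ³ →L[ℝ] ℝ³) (C : ℝ),
      IsSuitableWeakSolutionOn 𝕊 1 0 u p → HasWeakSpatialGradientOn 𝕊 u G →
      typeIBound (Iio (0 : ℝ) ×ˢ univ) u p G < ⊤ → HasTypeIDecay C u → IsBackwardSingularPoint u 0 →
      (∀ lam : ℝ, 0 < lam → SameScar (nsRescale lam u) u) → False := by
  intro u p G C hs hg hI hd hsing hhom
  have hC : 0 < C := pos_const_of_apexSingular hd hsing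
  obtain ⟨V, hae, hm, hdV⟩ := stub_apexMildRepresentative u p G C hC hs hg hI hd
  obtain ⟨Q, hcl, hB⟩ := stub_apexRegularity V C hC hm hdV
  have hsV : IsBackwardSingularPoint V 0 := isBackwardSingularPoint_congr_ae hae hsing
  have hVcont : ContinuousOn (uncurry V) (Iio (0 : ℝ) ×ˢ (univ : Set ℝ³)) := hm.continuousOn_uncurry
  -- the homogeneous scar passes to the representative
  have hhomV : ∀ lam : ℝ, 0 < lam → SameScar (nsRescale lam V) V := fun lam hlam =>
    sameScar_congr_ae (ae_nsRescale_congr hae hlam) hae (hhom lam hlam)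
  -- isolation radius and orbit Lipschitz constant
  obtain ⟨ε, hε, hiso⟩ := stub_localScarUniqueness V Q C hC hm hdV hcl hB hsV
  obtain ⟨K, hK⟩ := stub_dilationGeneratorFlat V Q C hC hm hdV hcl hB hhomV
  obtain ⟨K', hK'⟩ := stub_zoomOrbitIncrement V Q C K hC hm hdV hB hK
  -- the covariance of the apex class (landed support `SimilarityCovariance`)
  have hCov := RellichScarSimilarityCovariance.similarityCovariance_proof u p G C hs hg hI hd hsing
  -- freezing the orbit in a window around `λ = 1`
  set δ : ℝ := min (1 / 2) (ε / (|K'| + 1)) with hδdef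
  have hδ : 0 < δ := lt_min (by norm_num) (div_pos hε (by positivity))
  have hwin : ∀ lam : ℝ, |lam - 1| < δ → 0 < lam → ∀ t < 0, ∀ x : ℝ³, nsRescale lam V t x = V t x := by
    intro lam hlamδ hlam
    have hlamI : lam ∈ Icc (1 / 2 : ℝ) 2 := by
      have h1 : |lam - 1| < 1 / 2 := hlamδ.trans_le (min_le_left _ _)
      rw [abs_lt] at h1
      constructor <;> linarith [h1.1, h1.2]
    -- smooth representative of the rescaled weak profile; it IS the rescaled representative on the slab
    obtain ⟨q₁, H₁, hs₁, hg₁, hI₁, hd₁, hsing₁⟩ := hCov.1 lam hlam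
    obtain ⟨V₁, hae₁, hm₁, hdV₁⟩ := stub_apexMildRepresentative (nsRescale lam u) q₁ H₁ C hC hs₁ hg₁ hI₁ hd₁
    obtain ⟨Q₁, hcl₁, hB₁⟩ := stub_apexRegularity V₁ C hC hm₁ hdV₁
    have hsV₁ : IsBackwardSingularPoint V₁ 0 := isBackwardSingularPoint_congr_ae hae₁ hsing₁
    have haeV₁ : uncurry V₁ =ᵐ[volume.restrict (Iio (0 : ℝ) ×ˢ (univ : Set ℝ³))]
        uncurry (nsRescale lam V) := hae₁.trans (ae_nsRescale_congr hae hlam).symm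
    have hEq : ∀ t < 0, ∀ x : ℝ³, V₁ t x = nsRescale lam V t x :=
      eq_on_slab_of_ae_eq hm₁.continuousOn_uncurry (continuousOn_uncurry_nsRescale hVcont hlam) haeV₁
    have hscar₁ : SameScar V₁ V := sameScar_congr_ae hae₁ hae (hhom lam hlam)
    have hclose : ∀ t < 0, ∀ x : ℝ³, ‖V₁ t x - V t x‖ ≤ ε * ((-t) / (‖x‖ + Real.sqrt (-t)) ^ 3) := by
      intro t ht x
      rw [hEq t ht x]
      refine (hK' lam hlamI t ht x).trans ?_
      refine mul_le_mul_of_nonneg_right ?_ (weight_pos ht x).le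
      have h2 : |lam - 1| < ε / (|K'| + 1) := hlamδ.trans_le (min_le_right _ _)
      have hK'le : K' ≤ |K'| + 1 := (le_abs_self K').trans (by linarith)
      calc K' * |lam - 1| ≤ (|K'| + 1) * |lam - 1| :=
            mul_le_mul_of_nonneg_right hK'le (abs_nonneg _)
        _ ≤ (|K'| + 1) * (ε / (|K'| + 1)) := mul_le_mul_of_nonneg_left h2.le (by positivity)
        _ = ε := by field_simp
    intro t ht x
    rw [← hEq t ht x]
    exact hiso V₁ Q₁ hm₁ hdV₁ hcl₁ hB₁ hsV₁ hscar₁ hclose t ht x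
  -- all scales, then a.e. self-similarity of `u`, then Tsai
  have hall := selfSimilar_of_window hδ hwin
  refine rellichScar_selfSimilarApexFatal_proof u p G C hs hg hI hd hsing ?_
  intro lam hlam
  have hssV : uncurry (nsRescale lam V) =ᵐ[volume.restrict (Iio (0 : ℝ) ×ˢ (univ : Set ℝ³))] uncurry V :=
    ae_slab_of_forall (P := fun z => uncurry (nsRescale lam V) z = uncurry V z) fun t ht x => hall lam hlam t ht x
  exact ae_selfSimilar_of_ae_eq hae.symm hlam hssV

/-- **No singular apex profile has an axisymmetric scar — from isolation** (rotation orbit frozen near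
`θ = 0` by `stub_rotationGeneratorFlat` + `stub_rotationOrbitIncrement` and isolation; window ⇒ exact
axisymmetry; `AxisymmetricApexFatal`). -/
theorem noAxisymmetricScarProfile_of_isolation (stub_localScarUniqueness :
    (∀ (V : ℝ → ℝ³ → ℝ³) (Q : ℝ → ℝ³ → ℝ) (C : ℝ), 0 < C →
        IsTypeIAncientMild C V → HasTypeIDecay C V → IsClassicalNSSolutionOn (Iio (0 : ℝ)) 1 0 V Q →
        ScaleInvariantBounds V Q → IsBackwardSingularPoint V 0 →
        ∃ ε : ℝ, 0 < ε ∧ ∀ (V' : ℝ → ℝ³ → ℝ³) (Q' : ℝ → ℝ³ → ℝ),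
          IsTypeIAncientMild C V' → HasTypeIDecay C V' → IsClassicalNSSolutionOn (Iio (0 : ℝ)) 1 0 V' Q' →
          ScaleInvariantBounds V' Q' → IsBackwardSingularPoint V' 0 → SameScar V' V →
          (∀ t < 0, ∀ x : ℝ³, ‖V' t x - V t x‖ ≤ ε * ((-t) / (‖x‖ + Real.sqrt (-t)) ^ 3)) →
          ∀ t < 0, ∀ x : ℝ³, V' t x = V t x)) :
    ∀ (u : ℝ → ℝ³ → ℝ³) (p : ℝ → ℝ³ → ℝ) (G : ℝ → ℝ³ → ℝ³ →L[ℝ] ℝ³) (C : ℝ),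
      IsSuitableWeakSolutionOn 𝕊 1 0 u p → HasWeakSpatialGradientOn 𝕊 u G →
      typeIBound (Iio (0 : ℝ) ×ˢ univ) u p G < ⊤ → HasTypeIDecay C u → IsBackwardSingularPoint u 0 →
      (∀ θ : ℝ, SameScar (fun t x => rotZ θ (u t (rotZ (-θ) x))) u) → False := by
  intro u p G C hs hg hI hd hsing hax
  have hC : 0 < C := pos_const_of_apexSingular hd hsing
  obtain ⟨V, hae, hm, hdV⟩ := stub_apexMildRepresentative u p G C hC hs hg hI hd
  obtain ⟨Q, hcl, hB⟩ := stub_apexRegularity V C hC hm hdV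
  have hsV : IsBackwardSingularPoint V 0 := isBackwardSingularPoint_congr_ae hae hsing
  have hVcont : ContinuousOn (uncurry V) (Iio (0 : ℝ) ×ˢ (univ : Set ℝ³)) := hm.continuousOn_uncurry
  have haxV : ∀ θ : ℝ, SameScar (fun t x => rotZ θ (V t (rotZ (-θ) x))) V := fun θ =>
    sameScar_congr_ae (ae_conj_congr hae θ) hae (hax θ)
  obtain ⟨ε, hε, hiso⟩ := stub_localScarUniqueness V Q C hC hm hdV hcl hB hsV
  obtain ⟨K, hK⟩ := stub_rotationGeneratorFlat V Q C hC hm hdV hcl hB haxV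
  have hK' := stub_rotationOrbitIncrement V C K hm hK
  have hCov := RellichScarSimilarityCovariance.similarityCovariance_proof u p G C hs hg hI hd hsing
  set δ : ℝ := ε / (|K| + 1) with hδdef
  have hδ : 0 < δ := div_pos hε (by positivity)
  have hwin : ∀ θ : ℝ, |θ| < δ → ∀ t < 0, ∀ x : ℝ³, rotZ θ (V t (rotZ (-θ) x)) = V t x := by
    intro θ hθ
    obtain ⟨q₁, H₁, hs₁, hg₁, hI₁, hd₁, hsing₁⟩ := hCov.2 θ
    obtain ⟨V₁, hae₁, hm₁, hdV₁⟩ :=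
      stub_apexMildRepresentative (fun t x => rotZ θ (u t (rotZ (-θ) x))) q₁ H₁ C hC hs₁ hg₁ hI₁ hd₁
    obtain ⟨Q₁, hcl₁, hB₁⟩ := stub_apexRegularity V₁ C hC hm₁ hdV₁
    have hsV₁ : IsBackwardSingularPoint V₁ 0 := isBackwardSingularPoint_congr_ae hae₁ hsing₁
    have haeV₁ : uncurry V₁ =ᵐ[volume.restrict (Iio (0 : ℝ) ×ˢ (univ : Set ℝ³))]
        uncurry (fun t x => rotZ θ (V t (rotZ (-θ) x))) := hae₁.trans (ae_conj_congr hae θ).symm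
    have hEq : ∀ t < 0, ∀ x : ℝ³, V₁ t x = rotZ θ (V t (rotZ (-θ) x)) :=
      eq_on_slab_of_ae_eq hm₁.continuousOn_uncurry (continuousOn_uncurry_conj hVcont θ) haeV₁
    have hscar₁ : SameScar V₁ V := sameScar_congr_ae hae₁ hae (hax θ)
    have hclose : ∀ t < 0, ∀ x : ℝ³, ‖V₁ t x - V t x‖ ≤ ε * ((-t) / (‖x‖ + Real.sqrt (-t)) ^ 3) := by
      intro t ht x
      rw [hEq t ht x]
      refine (hK' θ t ht x).trans ?_
      refine mul_le_mul_of_nonneg_right ?_ (weight_pos ht x).le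
      have hKle : K ≤ |K| + 1 := (le_abs_self K).trans (by linarith)
      calc K * |θ| ≤ (|K| + 1) * |θ| := mul_le_mul_of_nonneg_right hKle (abs_nonneg _)
        _ ≤ (|K| + 1) * (ε / (|K| + 1)) := mul_le_mul_of_nonneg_left hθ.le (by positivity)
        _ = ε := by field_simp
    intro t ht x
    rw [← hEq t ht x]
    exact hiso V₁ Q₁ hm₁ hdV₁ hcl₁ hB₁ hsV₁ hscar₁ hclose t ht x
  have hall := axisymmetric_of_window hδ hwin
  refine rellichScar_axisymmetricApexFatal_proof u p G C hs hg hI hd hsing ?_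
  intro θ
  have h1 : uncurry (fun t x => rotZ θ (V t (rotZ (-θ) x)))
      =ᵐ[volume.restrict (Iio (0 : ℝ) ×ˢ (univ : Set ℝ³))] uncurry V :=
    ae_slab_of_forall (P := fun z => uncurry (fun t x => rotZ θ (V t (rotZ (-θ) x))) z = uncurry V z)
      fun t ht x => hall θ t ht x
  exact ((ae_conj_congr hae θ).symm.trans h1).trans hae

/-- **The crux from `SymmetricScarExists` and isolation.**  If `ScarRigidity` failed, a singular apex profile would exist
(`exists_singular_apex_of_not_scarRigidity`); `SymmetricScarExists` (item 11718, hypothesis) upgrades it to one with a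
homogeneous or axisymmetric scar, and the two theorems above exclude both. -/
theorem scarRigidity_of_symmetricScarExists_of_isolation (stub_symmetricScarExists : SymmetricScarExists)
    (stub_localScarUniqueness :
    (∀ (V : ℝ → ℝ³ → ℝ³) (Q : ℝ → ℝ³ → ℝ) (C : ℝ), 0 < C →
        IsTypeIAncientMild C V → HasTypeIDecay C V → IsClassicalNSSolutionOn (Iio (0 : ℝ)) 1 0 V Q →
        ScaleInvariantBounds V Q → IsBackwardSingularPoint V 0 →
        ∃ ε : ℝ, 0 < ε ∧ ∀ (V' : ℝ → ℝ³ → ℝ³) (Q' : ℝ → ℝ³ → ℝ),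
          IsTypeIAncientMild C V' → HasTypeIDecay C V' → IsClassicalNSSolutionOn (Iio (0 : ℝ)) 1 0 V' Q' →
          ScaleInvariantBounds V' Q' → IsBackwardSingularPoint V' 0 → SameScar V' V →
          (∀ t < 0, ∀ x : ℝ³, ‖V' t x - V t x‖ ≤ ε * ((-t) / (‖x‖ + Real.sqrt (-t)) ^ 3)) →
          ∀ t < 0, ∀ x : ℝ³, V' t x = V t x)) :
    ScarRigidity := by
  by_contra h
  obtain ⟨C, u, p, G, _, hs, hg, hI, hd, hsing⟩ := exists_singular_apex_of_not_scarRigidity h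
  obtain ⟨C', z, pz, Gz, hsz, hgz, hIz, hdz, hsingz, hsym⟩ :=
    stub_symmetricScarExists C ⟨u, p, G, hs, hg, hI, hd, hsing⟩
  rcases hsym with hhom | hax
  · exact noHomogeneousScarProfile_of_isolation stub_localScarUniqueness z pz Gz C' hsz hgz hIz hdz hsingz hhom
  · exact noAxisymmetricScarProfile_of_isolation stub_localScarUniqueness z pz Gz C' hsz hgz hIz hdz hsingz hax

/-- **Registered tools stub of the reduction** (`ledger workitem stub-add … --name stub_generatorHullReduction`): the
three reductions of this file in one conjunction — isolation ⇒ no homogeneous-scar profile, isolation ⇒ no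
axisymmetric-scar profile, `SymmetricScarExists` ∧ isolation ⇒ `ScarRigidity`. -/
theorem stub_generatorHullReduction :
    ((∀ (V : ℝ → ℝ³ → ℝ³) (Q : ℝ → ℝ³ → ℝ) (C : ℝ), 0 < C →
      IsTypeIAncientMild C V → HasTypeIDecay C V → IsClassicalNSSolutionOn (Iio (0 : ℝ)) 1 0 V Q →
      ScaleInvariantBounds V Q → IsBackwardSingularPoint V 0 →
      ∃ ε : ℝ, 0 < ε ∧ ∀ (V' : ℝ → ℝ³ → ℝ³) (Q' : ℝ → ℝ³ → ℝ),
        IsTypeIAncientMild C V' → HasTypeIDecay C V' → IsClassicalNSSolutionOn (Iio (0 : ℝ)) 1 0 V' Q' →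
        ScaleInvariantBounds V' Q' → IsBackwardSingularPoint V' 0 → SameScar V' V →
        (∀ t < 0, ∀ x : ℝ³, ‖V' t x - V t x‖ ≤ ε * ((-t) / (‖x‖ + Real.sqrt (-t)) ^ 3)) →
        ∀ t < 0, ∀ x : ℝ³, V' t x = V t x) →
      (∀ (u : ℝ → ℝ³ → ℝ³) (p : ℝ → ℝ³ → ℝ) (G : ℝ → ℝ³ → ℝ³ →L[ℝ] ℝ³) (C : ℝ),
      IsSuitableWeakSolutionOn 𝕊 1 0 u p → HasWeakSpatialGradientOn 𝕊 u G →
      typeIBound (Iio (0 : ℝ) ×ˢ univ) u p G < ⊤ → HasTypeIDecay C u → IsBackwardSingularPoint u 0 →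
      (∀ lam : ℝ, 0 < lam → SameScar (nsRescale lam u) u) → False)) ∧
    ((∀ (V : ℝ → ℝ³ → ℝ³) (Q : ℝ → ℝ³ → ℝ) (C : ℝ), 0 < C →
      IsTypeIAncientMild C V → HasTypeIDecay C V → IsClassicalNSSolutionOn (Iio (0 : ℝ)) 1 0 V Q →
      ScaleInvariantBounds V Q → IsBackwardSingularPoint V 0 →
      ∃ ε : ℝ, 0 < ε ∧ ∀ (V' : ℝ → ℝ³ → ℝ³) (Q' : ℝ → ℝ³ → ℝ),
        IsTypeIAncientMild C V' → HasTypeIDecay C V' → IsClassicalNSSolutionOn (Iio (0 : ℝ)) 1 0 V' Q' →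
        ScaleInvariantBounds V' Q' → IsBackwardSingularPoint V' 0 → SameScar V' V →
        (∀ t < 0, ∀ x : ℝ³, ‖V' t x - V t x‖ ≤ ε * ((-t) / (‖x‖ + Real.sqrt (-t)) ^ 3)) →
        ∀ t < 0, ∀ x : ℝ³, V' t x = V t x) →
      (∀ (u : ℝ → ℝ³ → ℝ³) (p : ℝ → ℝ³ → ℝ) (G : ℝ → ℝ³ → ℝ³ →L[ℝ] ℝ³) (C : ℝ),
      IsSuitableWeakSolutionOn 𝕊 1 0 u p → HasWeakSpatialGradientOn 𝕊 u G →
      typeIBound (Iio (0 : ℝ) ×ˢ univ) u p G < ⊤ → HasTypeIDecay C u → IsBackwardSingularPoint u 0 →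
      (∀ θ : ℝ, SameScar (fun t x => rotZ θ (u t (rotZ (-θ) x))) u) → False)) ∧
    (SymmetricScarExists → (∀ (V : ℝ → ℝ³ → ℝ³) (Q : ℝ → ℝ³ → ℝ) (C : ℝ), 0 < C →
      IsTypeIAncientMild C V → HasTypeIDecay C V → IsClassicalNSSolutionOn (Iio (0 : ℝ)) 1 0 V Q →
      ScaleInvariantBounds V Q → IsBackwardSingularPoint V 0 →
      ∃ ε : ℝ, 0 < ε ∧ ∀ (V' : ℝ → ℝ³ → ℝ³) (Q' : ℝ → ℝ³ → ℝ),
        IsTypeIAncientMild C V' → HasTypeIDecay C V' → IsClassicalNSSolutionOn (Iio (0 : ℝ)) 1 0 V' Q' →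
        ScaleInvariantBounds V' Q' → IsBackwardSingularPoint V' 0 → SameScar V' V →
        (∀ t < 0, ∀ x : ℝ³, ‖V' t x - V t x‖ ≤ ε * ((-t) / (‖x‖ + Real.sqrt (-t)) ^ 3)) →
        ∀ t < 0, ∀ x : ℝ³, V' t x = V t x) → ScarRigidity) :=
  ⟨noHomogeneousScarProfile_of_isolation, noAxisymmetricScarProfile_of_isolation,
    scarRigidity_of_symmetricScarExists_of_isolation⟩

end Summit.NavierStokesRegularity.NavierStokesRegularity.Theorems.RellichScarScarRigidity

end
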